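import Summits.Parity.BatemanHorn.Theses.IsogenyRedei
import Summits.Parity.BatemanHorn.Theorems.IsogenyRedeiSplitBlockJacobiWeylDefs
import Summits.Parity.BatemanHorn.Theorems.IsogenyRedeiSplitBlockJacobiPairForm
import Summits.Parity.BatemanHorn.Theorems.IsogenyRedeiSplitBlockJacobiPoissonReduction
import Summits.Parity.BatemanHorn.Theorems.IsogenyRedeiSplitBlockJacobiWeylCornerBalanced

/-!
# Skeleton — crux `SplitBlockJacobiCorner` (stmt-Parity-15002), line `Sketch`
# (= idea `cauchy-free-twisted-type-i2`, crux-ideate round 1, ideator 2; lead prover-line-stmt-Parity-15002-0)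

Crux (FIXED, by name): `Summit.Parity.BatemanHorn.Theses.IsogenyRedei.SplitBlockJacobiCorner` =
`∃ δ > 0, ∀ θ > 1/2, ∀ μ ∈ [1−δ, 2−2θ):  Σ_{t ≤ x} Σ_{(Q,Q′) ∈ pf(t²+1)², x^θ < Q < Q′, QQ′ ≤ x^{2−μ}} (Q|Q′) = o(x)`.

## Composition (kernel-checked below, no `sorry` outside `stub_*`)

* `stub_cornerPairForm` (M, TRUE, finite combinatorics = the landed `stub_pairForm` with the extra product cut carried on
  both sides): for `x ≥ 4` the corner sum equals `Σ_{q ∈ P_θ(x), QQ′ ≤ x^{2−μ}} (Q|Q′)·A_{QQ′}(x)` over the landed free pair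
  set `pairs θ x` with the landed small-root count `rootCount`.
* `A_q(x) = 4x/q + disc_q(x)` splits this into the CORNER EXPECTED PART
  `E^c_{θ,μ}(x) = Σ_{q ∈ P_θ(x), QQ′ ≤ x^{2−μ}} (Q|Q′)·4x/(QQ′)` and EXACTLY the landed bulk discrepancy `Dbulk θ μ x`.
* `stub_cornerExpectedPart` (M–L, TRUE): `E^c = o(x)` — by rescaling (`y ≍ x^{1−μ/2}`, `θ′ = θ/(1−μ/2) ∈ (1/2,1)`) it is the
  landed `stub_expectedPart θ′` at `y` up to two boundary layers (one prime `Q` in `(y^{θ′}, x^θ]`, and the hyperbolic shell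
  `y² < QQ′ ≤ y² + 2y`), both `O(x log x /√x)`.
* `Dbulk θ μ x = o(x)` is the LANDED `stub_poissonReduction θ μ` given `TierWeylBound θ μ`, which is the LANDED
  `tierWeylBound_of_mixedBilinearBalanced` given `MixedBilinearBalanced δ₀` for `μ ≥ 1 − δ₀/3` (take `δ := δ₀/3`).
* `MixedBilinearBalanced δ₀` (drefute-g2's repaired, aspect-bounded bilinear power saving for
  `T_h = Σ_{Q,Q′}(Q|Q′)S(h,QQ′)`) is the ONE open estimate; the line derives it as
  `stub_mbb_of_typeI2_typeII` (two-variable Heath-Brown identity, L–XL bookkeeping) from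
  `stub_typeI2_typeII_inputs : ∃ η > 0, SmoothTwistedTypeI2 η ∧ ShortFactorTwistedTypeII η` (K1 = the BET, Merikoski's open
  Type-I₂ sum for n²+1, Jacobi-twisted; K2 = Merikoski-range Type II with a cross character).
* `stub_gaussCoordinateSplit` (T0, M, TRUE, elementary): the Gauss-coordinate split of the root phase — the line's first lemma,
  a tool inside K1 (not consumed by the composition; registered so that it can land `--supports`).

`SplitBlockJacobiCorner_of_mbb` : MBB ∧ stub_cornerPairForm ∧ stub_cornerExpectedPart ⇒ crux (proved);
`SplitBlockJacobiCorner_of` : the four load-bearing stubs ⇒ crux BY NAME (proved); `SplitBlockJacobiCorner_of_stubs` wires the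
`sorry`s.  Disproof used: no `Disproof.lean` for stmt-Parity-15002 exists yet; from the sister crux's record: `1/2 < θ` is kept
(load-bearing in `stub_poissonReduction`: `q = QQ′ > x`), `h ≠ 0` and the aspect bound `P₂ ≤ 8P₁^{1+δ₀}` are built into MBB
(DrefuteG2 F2/F4), K1/K2 quantify over `k ≠ 0` and near-balanced boxes only.
-/

noncomputable section

open Finset Filter

namespace Summit.Parity.BatemanHorn.Cruxes.SplitBlockJacobiCorner.Sketch

open Summit.Parity.BatemanHorn.Cruxes.SplitBlockJacobi.CofactorRootDiscrepancy

/-! ### §1 Vocabulary of the line (verbatim from `Ideator2Sketch.lean`, over the landed `rootWeylSum` / `twistedSum`) -/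

/-- The SMOOTH twisted sum: both moduli `n, q ≡ 1 (mod 4)` FREE in dyadic boxes (no primality),
Jacobi twist `(n|q)`, root Weyl sum of `−1` modulo `L·n·q` at frequency `k`. -/
def smoothTwistedSum (k : ℤ) (L N₁ N₂ : ℕ) : ℂ :=
  ∑ n ∈ (Finset.Ioc N₁ (2 * N₁)).filter (fun n : ℕ => n % 4 = 1),
    ∑ q ∈ (Finset.Ioc N₂ (2 * N₂)).filter (fun q : ℕ => q % 4 = 1 ∧ Nat.Coprime n q),
      (jacobiSym (n : ℤ) q : ℂ) * rootWeylSum k (L * n * q)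

/-- **K1 `SmoothTwistedTypeI2 η`** (the bet; Merikoski's open "Type I₂", Jacobi-twisted): a power saving
`(N₁N₂)^{−η}` for `smoothTwistedSum` in near-balanced boxes `N₁ ≤ N₂ ≤ N₁^{1+η}`, uniformly for
auxiliary levels `1 ≤ L ≤ N₁^η` and frequencies `0 < |k| ≤ N₁^η`. -/
def SmoothTwistedTypeI2 (η : ℝ) : Prop :=
  ∃ N₀ : ℕ, ∀ N₁ N₂ L : ℕ, N₀ ≤ N₁ → N₁ ≤ N₂ → (N₂ : ℝ) ≤ (N₁ : ℝ) ^ (1 + η) →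
    1 ≤ L → (L : ℝ) ≤ (N₁ : ℝ) ^ η →
      ∀ k : ℤ, k ≠ 0 → (|k| : ℝ) ≤ (N₁ : ℝ) ^ η →
        ‖smoothTwistedSum k L N₁ N₂‖ ≤ ((N₁ * N₂ : ℕ) : ℝ) ^ (1 - η)

/-- **K2 `ShortFactorTwistedTypeII η`** (Merikoski-range Type II with the Jacobi twist carried as a
cross character): for `M ≤ (N₁N₂)^{13/100}`, arbitrary unit coefficients `aₘ` on the short factor and `β` on the
long co-variable, the twisted root sum over moduli `(m·f)·q` saves a power. -/
def ShortFactorTwistedTypeII (η : ℝ) : Prop :=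
  ∃ N₀ : ℕ, ∀ N₁ N₂ M : ℕ, N₀ ≤ N₁ → N₁ ≤ N₂ → (N₂ : ℝ) ≤ (N₁ : ℝ) ^ (1 + η) →
    (N₁ : ℝ) ^ η ≤ M → (M : ℝ) ≤ ((N₁ * N₂ : ℕ) : ℝ) ^ (13 / 100 : ℝ) →
      ∀ (am : ℕ → ℂ) (β : ℕ → ℂ), (∀ m, ‖am m‖ ≤ 1) → (∀ q, ‖β q‖ ≤ 1) →
        ∀ k : ℤ, k ≠ 0 → (|k| : ℝ) ≤ (N₁ : ℝ) ^ η →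
          ‖∑ m ∈ Finset.Ioc M (2 * M), ∑ f ∈ Finset.Ioc (N₁ / (2 * M)) (2 * N₁ / M),
              ∑ q ∈ (Finset.Ioc N₂ (2 * N₂)).filter (fun q : ℕ => q % 4 = 1 ∧ Nat.Coprime (m * f) q),
                am m * β q * (jacobiSym ((m * f : ℕ) : ℤ) q : ℂ) * rootWeylSum k (m * f * q)‖ ≤
            ((N₁ * N₂ : ℕ) : ℝ) ^ (1 - η)

/-- drefute-g2's REPAIRED corner hypothesis `MixedBilinearBalanced δ₀` (aspect-bounded), over the landed
vocabulary `twistedSum` (= Σ_{Q,Q' prime ≡ 1 (4)} (Q|Q')·S(h,QQ')). -/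
def MixedBilinearBalanced (δ₀ : ℝ) : Prop :=
  ∃ P₀ : ℕ, ∀ P₁ P₁' P₂ P₂' : ℕ, P₀ ≤ P₁ → P₁ ≤ P₁' → P₁' ≤ 2 * P₁ → P₁ ≤ P₂ → P₂ ≤ P₂' →
    P₂' ≤ 2 * P₂ → (P₂ : ℝ) ≤ 8 * (P₁ : ℝ) ^ (1 + δ₀) →
      ∀ h : ℤ, h ≠ 0 → (|h| : ℝ) ≤ ((P₁ * P₂ : ℕ) : ℝ) ^ δ₀ →
        ‖twistedSum h P₁ P₁' P₂ P₂'‖ ≤ ((P₁ * P₂ : ℕ) : ℝ) ^ (1 - δ₀)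

/-! ### §2 The named statements of the line -/

/-- Corner pair form: the corner sum on the pair side (product cut carried along). -/
def CornerPairForm : Prop :=
  ∀ θ μ : ℝ, 1 / 2 < θ → ∀ x : ℕ, 4 ≤ x →
    (∑ t ∈ Finset.Icc 1 x, ∑ q ∈ ((t ^ 2 + 1).primeFactors ×ˢ (t ^ 2 + 1).primeFactors).filter
        (fun q : ℕ × ℕ => (x : ℝ) ^ θ < (q.1 : ℝ) ∧ q.1 < q.2 ∧ ((q.1 * q.2 : ℕ) : ℝ) ≤ (x : ℝ) ^ (2 - μ)),
        (jacobiSym (q.1 : ℤ) q.2 : ℝ)) =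
      ∑ q ∈ (pairs θ x).filter (fun q : ℕ × ℕ => ((q.1 * q.2 : ℕ) : ℝ) ≤ (x : ℝ) ^ (2 - μ)),
        (jacobiSym (q.1 : ℤ) q.2 : ℝ) * (rootCount (q.1 * q.2) x : ℝ)

/-- Corner expected part cancels: `E^c_{θ,μ}(x) = o(x)`. -/
def CornerExpectedPart : Prop :=
  ∀ θ μ : ℝ, 1 / 2 < θ → 0 < μ → μ < 2 - 2 * θ → ∀ ε : ℝ, 0 < ε → ∀ᶠ x : ℕ in atTop,
    |∑ q ∈ (pairs θ x).filter (fun q : ℕ × ℕ => ((q.1 * q.2 : ℕ) : ℝ) ≤ (x : ℝ) ^ (2 - μ)),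
        (jacobiSym (q.1 : ℤ) q.2 : ℝ) * (4 * (x : ℝ) / ((q.1 * q.2 : ℕ) : ℝ))| ≤ ε * x

/-- The line's inputs K1 ∧ K2 at a common `η > 0`. -/
def TypeI2TypeIIInputs : Prop :=
  ∃ η : ℝ, 0 < η ∧ SmoothTwistedTypeI2 η ∧ ShortFactorTwistedTypeII η

/-- The line's reduction: K1 ∧ K2 ⇒ MBB(δ₀) for some `0 < δ₀ ≤ 1`. -/
def MbbOfTypeI2TypeII : Prop :=
  TypeI2TypeIIInputs → ∃ δ₀ : ℝ, 0 < δ₀ ∧ δ₀ ≤ 1 ∧ MixedBilinearBalanced δ₀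

/-! ### §3 Registered stubs (`sorry` lives ONLY here) -/

/-- **stub_cornerPairForm** (M, TRUE): pair-side Fubini with the product cut `QQ′ ≤ x^{2−μ}` on both sides; same proof as the
landed `stub_pairForm` (`pairForm_filter_eq` termwise, `Finset.filter_filter`, `Finset.sum_comm'`). -/
theorem stub_cornerPairForm :
    ∀ θ μ : ℝ, 1 / 2 < θ → ∀ x : ℕ, 4 ≤ x →
      (∑ t ∈ Finset.Icc 1 x, ∑ q ∈ ((t ^ 2 + 1).primeFactors ×ˢ (t ^ 2 + 1).primeFactors).filter
          (fun q : ℕ × ℕ => (x : ℝ) ^ θ < (q.1 : ℝ) ∧ q.1 < q.2 ∧ ((q.1 * q.2 : ℕ) : ℝ) ≤ (x : ℝ) ^ (2 - μ)),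
          (jacobiSym (q.1 : ℤ) q.2 : ℝ)) =
        ∑ q ∈ (pairs θ x).filter (fun q : ℕ × ℕ => ((q.1 * q.2 : ℕ) : ℝ) ≤ (x : ℝ) ^ (2 - μ)),
          (jacobiSym (q.1 : ℤ) q.2 : ℝ) * (rootCount (q.1 * q.2) x : ℝ) := by
  sorry

/-- **stub_cornerExpectedPart** (M–L, TRUE): the corner expected part is `o(x)`; rescale to the landed `stub_expectedPart θ′`
at `y = ⌊x^{1−μ/2}⌋`, `θ′ = θ/(1−μ/2) ∈ (1/2, 1)`, bounding the two boundary layers trivially. -/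
theorem stub_cornerExpectedPart :
    ∀ θ μ : ℝ, 1 / 2 < θ → 0 < μ → μ < 2 - 2 * θ → ∀ ε : ℝ, 0 < ε → ∀ᶠ x : ℕ in atTop,
      |∑ q ∈ (pairs θ x).filter (fun q : ℕ × ℕ => ((q.1 * q.2 : ℕ) : ℝ) ≤ (x : ℝ) ^ (2 - μ)),
          (jacobiSym (q.1 : ℤ) q.2 : ℝ) * (4 * (x : ℝ) / ((q.1 * q.2 : ℕ) : ℝ))| ≤ ε * x := by
  sorry

/-- **stub_gaussCoordinateSplit** (T0, M, TRUE, elementary): for `Q = a² + b²`, `0 < b`, `gcd(b, a·n) = 1`, `gcd(n, Q) = 1`,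
with `ν := a·b⁻¹ (mod Q)`, `n̄ := n⁻¹ (mod Q)`, `u := (a n)⁻¹ (mod b)`, `v := (b Q)⁻¹ (mod n)` (least non-negative residues):
`e(h ν n̄ / Q) = e(−h u / b) · e(−h a v / n) · e(h a / (b n Q))`.  (Solve `b n X ≡ a (mod Q)` as `X = (a + Q y)/(b n)`,
`y ≡ −a Q⁻¹ (mod b n)`, and split `1/(b n)` by CRT.)  Stated with `e(r) = exp(2π i r)` written out. -/
theorem stub_gaussCoordinateSplit :
    ∀ (a : ℤ) (b Q n : ℕ) (h : ℤ), 0 < b → 0 < n → (Q : ℤ) = a ^ 2 + (b : ℤ) ^ 2 →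
      Int.gcd (b : ℤ) (a * n) = 1 → Nat.Coprime n Q →
        Complex.exp (2 * Real.pi * Complex.I *
            (((h * ((((a : ZMod Q) * ((b : ZMod Q))⁻¹).val : ℕ) : ℤ) * ((((n : ZMod Q))⁻¹.val : ℕ) : ℤ) : ℤ) : ℝ) /
              (Q : ℝ) : ℝ)) =
          Complex.exp (2 * Real.pi * Complex.I *
              ((-((h * (((((a * n : ℤ) : ZMod b))⁻¹.val : ℕ) : ℤ) : ℤ) : ℝ)) / (b : ℝ) : ℝ)) *
            Complex.exp (2 * Real.pi * Complex.I *
              ((-((h * a * (((((b * Q : ℕ) : ZMod n))⁻¹.val : ℕ) : ℤ) : ℤ) : ℝ)) / (n : ℝ) : ℝ)) *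
            Complex.exp (2 * Real.pi * Complex.I * ((((h * a : ℤ) : ℝ) / ((b : ℝ) * n * Q) : ℝ) : ℂ)) := by
  sorry

/-- **stub_typeI2_typeII_inputs** (K1 ∧ K2 at a common `η > 0`; K1 OPEN = the line's bet, hardest, held by the lead). -/
theorem stub_typeI2_typeII_inputs :
    ∃ η : ℝ, 0 < η ∧ SmoothTwistedTypeI2 η ∧ ShortFactorTwistedTypeII η := by
  sorry

/-- **stub_mbb_of_typeI2_typeII** (L–XL): Heath-Brown's identity applied to BOTH prime indicators of `twistedSum` expresses it
through smooth twisted Type-I₂ pieces and short-factor Type-II pieces; hence K1 ∧ K2 ⇒ MBB(δ₀) for some `0 < δ₀ ≤ 1`. -/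
theorem stub_mbb_of_typeI2_typeII :
    (∃ η : ℝ, 0 < η ∧ SmoothTwistedTypeI2 η ∧ ShortFactorTwistedTypeII η) →
      ∃ δ₀ : ℝ, 0 < δ₀ ∧ δ₀ ≤ 1 ∧ MixedBilinearBalanced δ₀ := by
  sorry

/-! ### §4 Consistency: each named statement IS its registered stub -/

theorem cornerPairForm_holds : CornerPairForm := stub_cornerPairForm
theorem cornerExpectedPart_holds : CornerExpectedPart := stub_cornerExpectedPart
theorem typeI2TypeIIInputs_holds : TypeI2TypeIIInputs := stub_typeI2_typeII_inputs
theorem mbbOfTypeI2TypeII_holds : MbbOfTypeI2TypeII := stub_mbb_of_typeI2_typeII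

/-! ### §5 Name-keyed aliases (hypotheses of the composition) -/
namespace Registered

/-- Alias of `CornerPairForm` keyed by the registered stub name. -/
abbrev stub_cornerPairForm : Prop := CornerPairForm
/-- Alias of `CornerExpectedPart` keyed by the registered stub name. -/
abbrev stub_cornerExpectedPart : Prop := CornerExpectedPart
/-- Alias of `TypeI2TypeIIInputs` keyed by the registered stub name. -/
abbrev stub_typeI2_typeII_inputs : Prop := TypeI2TypeIIInputs
/-- Alias of `MbbOfTypeI2TypeII` keyed by the registered stub name. -/
abbrev stub_mbb_of_typeI2_typeII : Prop := MbbOfTypeI2TypeII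

end Registered

/-! ### §6 The composition (kernel-checked, no `sorry`) -/

/-- **MBB ⇒ the corner** (with the two corner bookkeeping statements): take `δ := δ₀/3`; for `1/2 < θ`, `1 − δ ≤ μ < 2 − 2θ`
one has `θ < 1`, `0 < μ < 1`; `TierWeylBound θ μ` by the landed `tierWeylBound_of_mixedBilinearBalanced`, `Dbulk = o(x)` by the
landed `stub_poissonReduction`, `E^c = o(x)` by the corner expected part, and the corner sum is `E^c + Dbulk` by the corner pair
form and `A_q = 4x/q + disc_q`. -/
theorem SplitBlockJacobiCorner_of_mbb (hM : ∃ δ₀ : ℝ, 0 < δ₀ ∧ δ₀ ≤ 1 ∧ MixedBilinearBalanced δ₀)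
    (h₁ : CornerPairForm) (h₂ : CornerExpectedPart) :
    Summit.Parity.BatemanHorn.Theses.IsogenyRedei.SplitBlockJacobiCorner := by
  obtain ⟨δ₀, hδ₀, hδ₁, hMBB⟩ := hM
  refine ⟨δ₀ / 3, by positivity, ?_⟩
  intro θ μ hθ hμ hμ2
  have hθ1 : θ < 1 := by linarith
  have hμ0 : 0 < μ := by linarith
  have hμ1 : μ < 1 := by linarith
  -- the tier Weyl bound in the corner, from MBB (landed corner implication, defs unfolded)
  have hTWB : TierWeylBound θ μ := by
    have key := tierWeylBound_of_mixedBilinearBalanced hδ₀ hδ₁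
      (by simpa only [MixedBilinearBalanced, twistedSum, rootWeylSum] using hMBB) θ μ hθ hθ1 hμ hμ1
    simpa only [TierWeylBound, twistedSum, rootWeylSum] using key
  rw [Asymptotics.isLittleO_iff]
  intro c hc
  have hc2 : 0 < c / 2 := by positivity
  have hB : ∀ᶠ x : ℕ in atTop, |Dbulk θ μ x| ≤ c / 2 * x :=
    stub_poissonReduction θ μ hθ hθ1 hμ0 hμ1 hTWB (c / 2) hc2
  have hE := h₂ θ μ hθ hμ0 hμ2 (c / 2) hc2
  filter_upwards [hB, hE, eventually_ge_atTop 4] with x hxB hxE hx4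
  have hsplit :
      (∑ t ∈ Finset.Icc 1 x, ∑ q ∈ ((t ^ 2 + 1).primeFactors ×ˢ (t ^ 2 + 1).primeFactors).filter
          (fun q : ℕ × ℕ => (x : ℝ) ^ θ < (q.1 : ℝ) ∧ q.1 < q.2 ∧ ((q.1 * q.2 : ℕ) : ℝ) ≤ (x : ℝ) ^ (2 - μ)),
          (jacobiSym (q.1 : ℤ) q.2 : ℝ)) =
        (∑ q ∈ (pairs θ x).filter (fun q : ℕ × ℕ => ((q.1 * q.2 : ℕ) : ℝ) ≤ (x : ℝ) ^ (2 - μ)),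
            (jacobiSym (q.1 : ℤ) q.2 : ℝ) * (4 * (x : ℝ) / ((q.1 * q.2 : ℕ) : ℝ))) + Dbulk θ μ x := by
    rw [h₁ θ μ hθ x hx4]
    have hpt : ∀ q ∈ (pairs θ x).filter (fun q : ℕ × ℕ => ((q.1 * q.2 : ℕ) : ℝ) ≤ (x : ℝ) ^ (2 - μ)),
        (jacobiSym (q.1 : ℤ) q.2 : ℝ) * (rootCount (q.1 * q.2) x : ℝ) =
          (jacobiSym (q.1 : ℤ) q.2 : ℝ) * (4 * (x : ℝ) / ((q.1 * q.2 : ℕ) : ℝ)) +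
            (jacobiSym (q.1 : ℤ) q.2 : ℝ) * disc (q.1 * q.2) x := by
      intro q _
      unfold disc
      ring
    rw [Finset.sum_congr rfl hpt, Finset.sum_add_distrib]
    rfl
  show ‖_‖ ≤ c * ‖(x : ℝ)‖
  rw [hsplit, Real.norm_eq_abs, Real.norm_eq_abs, Nat.abs_cast]
  have hA := abs_add_le
    (∑ q ∈ (pairs θ x).filter (fun q : ℕ × ℕ => ((q.1 * q.2 : ℕ) : ℝ) ≤ (x : ℝ) ^ (2 - μ)),
      (jacobiSym (q.1 : ℤ) q.2 : ℝ) * (4 * (x : ℝ) / ((q.1 * q.2 : ℕ) : ℝ))) (Dbulk θ μ x)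
  linarith

/-- **`SplitBlockJacobiCorner` from the four load-bearing stubs, BY NAME.** -/
theorem SplitBlockJacobiCorner_of (h₁ : Registered.stub_cornerPairForm) (h₂ : Registered.stub_cornerExpectedPart)
    (h₃ : Registered.stub_typeI2_typeII_inputs) (h₄ : Registered.stub_mbb_of_typeI2_typeII) :
    Summit.Parity.BatemanHorn.Theses.IsogenyRedei.SplitBlockJacobiCorner :=
  SplitBlockJacobiCorner_of_mbb (h₄ h₃) h₁ h₂

/-- Wiring check: the registered stubs feed `SplitBlockJacobiCorner_of` as stated. -/
theorem SplitBlockJacobiCorner_of_stubs : Summit.Parity.BatemanHorn.Theses.IsogenyRedei.SplitBlockJacobiCorner :=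
  SplitBlockJacobiCorner_of cornerPairForm_holds cornerExpectedPart_holds typeI2TypeIIInputs_holds
    mbbOfTypeI2TypeII_holds

end Summit.Parity.BatemanHorn.Cruxes.SplitBlockJacobiCorner.Sketch

end
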